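import Literature.AlgebraicGeometry.Frobenioids.Thm34SubHypInstances
import Literature.AlgebraicGeometry.Frobenioids.PerfectionSquareFSM
import Literature.AlgebraicGeometry.Frobenioids.BaseCategoryTheoreticityInstancesClosed
import Literature.AlgebraicGeometry.Frobenioids.BaseCategoryTheoreticityProofs
import Literature.AlgebraicGeometry.Frobenioids.ArithmeticFrobenioidThm64iVariants
import HarnessLib

/-!
# Frobenioids I, Theorem 3.4: the hypothesis / transport predicates of §3 AT THE GENUINE INSTANCES
# (D-0079 L-F [FrdI/II], pack D: FACT rows F-2691 `FSMHyp`, F-2692 `StdHyp`, F-2378 `IsFrobeniusCompatible`,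
# F-1233 `PreservesObj`, F-1234 `PreservesRel` — instance forms with the FACT declaration as conclusion head)

Mochizuki, *The geometry of Frobenioids I: the general theory*, Kyushu J. Math. **62** (2008) 293–400, §3,
Theorem 3.4, kurims p. 62 l. 2 – p. 63 l. 37 (line numbers of the cell's kurims render, running head = l. 1);
verbatim (p. 62 ll. 3–8): «For i = 1, 2, let Φ_i be a divisorial monoid on a connected, totally epimorphic category
D_i; C_i → F_{Φ_i} a Frobenioid; Ψ : C_1 ⥲ C_2 an equivalence of categories. Then:», (i) p. 62 ll. 9–10 «Suppose
that C_1, C_2 are of quasi-isotropic type. Then Ψ preserves the isotropic objects», (iii) p. 62 ll. 33–42 «Then Ψ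
preserves morphisms of Frobenius type, …» and «if C_1, C_2 admit a non-group-like object, then Ψ^{ℕ≥1} is the
identity automorphism», (v) p. 63 ll. 24–25 «Then Ψ preserves the base-identity endomorphisms and base-equivalent
pairs of co-objective morphisms» [doc-only v2: render line numbers corrected after abc-iut-L1-t13's audit LOW-1;
text unchanged; all declarations byte-identical]; and §6, Theorem 6.4
(i) p. 114 (the arithmetic Frobenioids `C_{K/F}` of Example 6.3 are Frobenioids of isotropic and rationally standard,
not group-like, type over a base of FSM-type).
[cite: MochizukiFrdI2008, Thm. 3.4 p.62] [cite: MochizukiFrdI2008, Thm. 6.4 (i) p.114]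

PROOF-ONLY file (cell abc-iut, D-0079 L-F sub-cell [FrdI/II], seat abc-iut-L1-d1 gen 5; `plan/L1/LF-FRD.tsv` pack D,
RULES (a)–(e): conclusion head = the FACT declaration; no `def`, no instance, no restated schema; inputs BY NAME).
The five FACT rows are PARAMETRISED hypothesis / transport predicates of §3 whose universal closures are refuted in
the tree (`Thm34SubHypInstances.lean`, `PerfectionFunctorialityCompatibleClosure.lean`, …); what print asserts
are their INSTANCE FORMS, recorded here with the declaration itself as head:

* `FrdI.Thm34Sub.fsmHyp_arith`, `FrdI.Thm34Sub.stdHyp_arith` — F-2691 / F-2692 at the arithmetic Frobenioids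
  `C_{K₁/F₁}`, `C_{K₂/F₂}` (the `p`-adic instances are abc-iut-f-049's `fsmHyp_padic` / `stdHyp_padic`);
* `PreFrobenioid.isFrobeniusCompatible_arith`, `PreFrobenioid.isFrobeniusCompatible_padic` — F-2378 for EVERY
  equivalence of arithmetic resp. `p`-adic Frobenioids over FSM-type bases (Thm. 3.4 (iii) in the tree's generality
  is abc-iut-L1-d1's `FrdI.isFrobeniusCompatible_of_isOfFSMType` / abc-iut-f-002's
  `PreFrobenioid.isFrobeniusCompatible_of_not_isGroupLikeObj`);
* `PreFrobenioidData.preservesObj_isIsotropic_of_isFrobenioid` — F-1233 in print's generality (Thm. 3.4 (i),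
  first clause, = the first conjunct of abc-iut-L1-t13's `FrdI.Thm34i_holds`) and `preservesObj_isIsotropic_arith`;
* `PreFrobenioidData.preservesRel_baseEquivalent_of_isFrobenioid` — F-1234 in print's generality (Thm. 3.4 (v),
  second clause, = a conjunct of `FrdI.thm34v_ofFunctor`) and `preservesRel_baseEquivalent_arith` (slim bases BY
  NAME: Thm. 6.4 (i) characterises when `D` is slim).
Honest framing: kernel bookkeeping of OUR typed renderings of a refereed 2008 statement; nothing here bears on, or
takes a side on, [IUTchIII] Cor. 3.12.
-/

namespace Literature.AlgebraicGeometry.Frobenioids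

open CategoryTheory Opposite
open PreFrobenioidData (ofFunctor)

universe w v v' u u'

/-! ### F-1233 `PreservesObj` and F-1234 `PreservesRel` in print's generality -/

namespace PreFrobenioidData

variable {D₁ : Type u} [Category.{v} D₁] {Φ₁ : D₁ᵒᵖ ⥤ CommMonCat.{w}} {C₁ : Type u'} [Category.{v'} C₁]
  {D₂ : Type u} [Category.{v} D₂] {Φ₂ : D₂ᵒᵖ ⥤ CommMonCat.{w}} {C₂ : Type u'} [Category.{v'} C₂]
  {F₁ : C₁ ⥤ ElemFrobenioid Φ₁} {F₂ : C₂ ⥤ ElemFrobenioid Φ₂}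

/-- **[FrdI] Thm. 3.4 (i), first clause — the instance form of F-1233 `PreservesObj`**: for Frobenioids `C₁`, `C₂`
of quasi-isotropic type and an equivalence `Ψ : C₁ ⥲ C₂`, «Ψ preserves the isotropic objects».
[cite: MochizukiFrdI2008, Thm. 3.4 (i) p.62] -/
theorem preservesObj_isIsotropic_of_isFrobenioid (hF₁ : PreFrobenioid.IsFrobenioid F₁)
    (hF₂ : PreFrobenioid.IsFrobenioid F₂) (Ψ : C₁ ≌ C₂) (hq₁ : (ofFunctor Φ₁ F₁).IsOfQuasiIsotropicType)
    (hq₂ : (ofFunctor Φ₂ F₂).IsOfQuasiIsotropicType) :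
    PreservesObj Ψ.functor (ofFunctor Φ₁ F₁).IsIsotropic (ofFunctor Φ₂ F₂).IsIsotropic :=
  (FrdI.Thm34i_holds F₁ F₂ hF₁ hF₂ Ψ hq₁ hq₂).1

/-- **[FrdI] Thm. 3.4 (v), second clause — the instance form of F-1234 `PreservesRel`**: for Frobenioids `C₁`, `C₂`
of standard type, (b) `HypB`, over slim bases, an equivalence `Ψ` «preserves … base-equivalent pairs of
co-objective morphisms». [cite: MochizukiFrdI2008, Thm. 3.4 (v) p.63] -/
theorem preservesRel_baseEquivalent_of_isFrobenioid (hF₁ : PreFrobenioid.IsFrobenioid F₁)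
    (hF₂ : PreFrobenioid.IsFrobenioid F₂) (Ψ : C₁ ≌ C₂) (hs₁ : (ofFunctor Φ₁ F₁).IsOfStandardType)
    (hs₂ : (ofFunctor Φ₂ F₂).IsOfStandardType) (hB : (ofFunctor Φ₁ F₁).HypB (ofFunctor Φ₂ F₂) Ψ)
    (hsl₁ : IsSlim D₁) (hsl₂ : IsSlim D₂) :
    PreservesRel Ψ.functor (fun ⦃_ _⦄ φ ψ => (ofFunctor Φ₁ F₁).BaseEquivalent φ ψ)
      (fun ⦃_ _⦄ φ ψ => (ofFunctor Φ₂ F₂).BaseEquivalent φ ψ) :=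
  (FrdI.thm34v_ofFunctor hF₁ hF₂ Ψ hs₁ hs₂ hB hsl₁ hsl₂).2.1

end PreFrobenioidData

/-! ### F-2691 `FSMHyp`, F-2692 `StdHyp` at the arithmetic Frobenioids `C_{K/F}` -/

section Arith

variable (F₁ : Type) [Field F₁] [NumberField F₁] (K₁ : Type) [Field K₁] [Algebra F₁ K₁] [IsGalois F₁ K₁]
  (F₂ : Type) [Field F₂] [NumberField F₂] (K₂ : Type) [Field K₂] [Algebra F₂ K₂] [IsGalois F₂ K₂]

/-- **F-2691 at `C_{K/F}`**: two arithmetic Frobenioids (Ex. 6.3) meet the hypothesis bundle `FSMHyp` of Thm. 3.4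
over FSM-type bases — Frobenioids (`arithFrobenioid_isFrobenioid`) of quasi-isotropic type with non-dilating `Φ`
(standard type, Thm. 6.4 (i): `arith_isOfStandardType`), over the FSM-type base `FinSubextCat`
(`FinSubextCat.isOfFSMType`), admitting non-group-like objects (`arith_not_isOfGroupLikeType`).
[cite: MochizukiFrdI2008, Thm. 6.4 (i) p.114] -/
theorem FrdI.Thm34Sub.fsmHyp_arith :
    FrdI.Thm34Sub.FSMHyp
      (ModelFrobenioid.toElem (arithDivisorFunctor F₁ K₁) (unitsFunctor F₁ K₁) (divNatTrans F₁ K₁))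
      (ModelFrobenioid.toElem (arithDivisorFunctor F₂ K₂) (unitsFunctor F₂ K₂) (divNatTrans F₂ K₂)) where
  isFrobenioid₁ := arithFrobenioid_isFrobenioid F₁ K₁
  isFrobenioid₂ := arithFrobenioid_isFrobenioid F₂ K₂
  quasiIsotropic₁ := (arith_isOfStandardType F₁ K₁).quasiIsotropic
  quasiIsotropic₂ := (arith_isOfStandardType F₂ K₂).quasiIsotropic
  fsm₁ := FinSubextCat.isOfFSMType F₁ K₁
  fsm₂ := FinSubextCat.isOfFSMType F₂ K₂
  nonDilating₁ := (arith_isOfStandardType F₁ K₁).nonDilating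
  nonDilating₂ := (arith_isOfStandardType F₂ K₂).nonDilating
  nonGroupLike₁ := not_forall.mp fun h => arith_not_isOfGroupLikeType F₁ K₁ ⟨h⟩
  nonGroupLike₂ := not_forall.mp fun h => arith_not_isOfGroupLikeType F₂ K₂ ⟨h⟩

/-- **F-2692 at `C_{K/F}`**: for ANY equivalence `Ψ : C_{K₁/F₁} ⥲ C_{K₂/F₂}` of arithmetic Frobenioids the hypothesis
bundle `StdHyp` of Thm. 3.4 (iii)–(v) over FSM-type bases holds — (a) standard type (Thm. 6.4 (i)), (b) `HypB`
vacuous since `C_{K₁/F₁}` is not of group-like type. [cite: MochizukiFrdI2008, Thm. 6.4 (i) p.114] -/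
theorem FrdI.Thm34Sub.stdHyp_arith (Ψ : arithFrobenioid F₁ K₁ ≌ arithFrobenioid F₂ K₂) :
    FrdI.Thm34Sub.StdHyp
      (ModelFrobenioid.toElem (arithDivisorFunctor F₁ K₁) (unitsFunctor F₁ K₁) (divNatTrans F₁ K₁))
      (ModelFrobenioid.toElem (arithDivisorFunctor F₂ K₂) (unitsFunctor F₂ K₂) (divNatTrans F₂ K₂)) Ψ where
  isFrobenioid₁ := arithFrobenioid_isFrobenioid F₁ K₁
  isFrobenioid₂ := arithFrobenioid_isFrobenioid F₂ K₂
  fsm₁ := FinSubextCat.isOfFSMType F₁ K₁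
  fsm₂ := FinSubextCat.isOfFSMType F₂ K₂
  standard₁ := arith_isOfStandardType F₁ K₁
  standard₂ := arith_isOfStandardType F₂ K₂
  hypB := fun hg _ => absurd hg (arith_not_isOfGroupLikeType F₁ K₁)

/-! ### F-2378 `IsFrobeniusCompatible` at the genuine instances -/

/-- **F-2378 at `C_{K/F}`** (Thm. 3.4 (iii) at the arithmetic Frobenioids): EVERY equivalence
`Ψ : C_{K₁/F₁} ⥲ C_{K₂/F₂}` carries arrows of Frobenius type to arrows of Frobenius type of the same Frobenius degree
(`FrdI.isFrobeniusCompatible_of_isOfFSMType` fed with `fsmHyp_arith`). [cite: MochizukiFrdI2008, Thm. 3.4 (iii) p.62] -/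
theorem PreFrobenioid.isFrobeniusCompatible_arith (Ψ : arithFrobenioid F₁ K₁ ≌ arithFrobenioid F₂ K₂) :
    PreFrobenioid.IsFrobeniusCompatible
      (ModelFrobenioid.toElem (arithDivisorFunctor F₁ K₁) (unitsFunctor F₁ K₁) (divNatTrans F₁ K₁))
      (ModelFrobenioid.toElem (arithDivisorFunctor F₂ K₂) (unitsFunctor F₂ K₂) (divNatTrans F₂ K₂)) Ψ.functor :=
  have h := FrdI.Thm34Sub.fsmHyp_arith F₁ K₁ F₂ K₂
  FrdI.isFrobeniusCompatible_of_isOfFSMType h.isFrobenioid₁ h.isFrobenioid₂ h.quasiIsotropic₁ h.quasiIsotropic₂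
    h.fsm₁ h.fsm₂ h.nonDilating₁ h.nonDilating₂ Ψ h.nonGroupLike₁ h.nonGroupLike₂

/-- **F-1233 at `C_{K/F}`**: every equivalence of arithmetic Frobenioids preserves the isotropic objects
(Thm. 3.4 (i); `C_{K/F}` is of quasi-isotropic type). [cite: MochizukiFrdI2008, Thm. 3.4 (i) p.62] -/
theorem PreFrobenioidData.preservesObj_isIsotropic_arith (Ψ : arithFrobenioid F₁ K₁ ≌ arithFrobenioid F₂ K₂) :
    PreFrobenioidData.PreservesObj Ψ.functor
      (ofFunctor (arithDivisorFunctor F₁ K₁)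
        (ModelFrobenioid.toElem (arithDivisorFunctor F₁ K₁) (unitsFunctor F₁ K₁) (divNatTrans F₁ K₁))).IsIsotropic
      (ofFunctor (arithDivisorFunctor F₂ K₂)
        (ModelFrobenioid.toElem (arithDivisorFunctor F₂ K₂) (unitsFunctor F₂ K₂) (divNatTrans F₂ K₂))).IsIsotropic :=
  PreFrobenioidData.preservesObj_isIsotropic_of_isFrobenioid (arithFrobenioid_isFrobenioid F₁ K₁)
    (arithFrobenioid_isFrobenioid F₂ K₂) Ψ (arith_isOfStandardType F₁ K₁).quasiIsotropic
    (arith_isOfStandardType F₂ K₂).quasiIsotropic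

/-- **F-1234 at `C_{K/F}`**, slim bases BY NAME (Thm. 6.4 (i): `D` is slim iff the subgroup of elements of
`Gal(K/F)` commuting with an open subgroup is trivial): every equivalence of arithmetic Frobenioids over slim bases
preserves base-equivalent pairs (Thm. 3.4 (v); standard type, `HypB` vacuous).
[cite: MochizukiFrdI2008, Thm. 3.4 (v) p.63] -/
theorem PreFrobenioidData.preservesRel_baseEquivalent_arith (Ψ : arithFrobenioid F₁ K₁ ≌ arithFrobenioid F₂ K₂)
    (hsl₁ : IsSlim (FinSubextCat F₁ K₁)) (hsl₂ : IsSlim (FinSubextCat F₂ K₂)) :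
    PreFrobenioidData.PreservesRel Ψ.functor
      (fun ⦃_ _⦄ φ ψ => (ofFunctor (arithDivisorFunctor F₁ K₁)
        (ModelFrobenioid.toElem (arithDivisorFunctor F₁ K₁) (unitsFunctor F₁ K₁) (divNatTrans F₁ K₁))).BaseEquivalent
          φ ψ)
      (fun ⦃_ _⦄ φ ψ => (ofFunctor (arithDivisorFunctor F₂ K₂)
        (ModelFrobenioid.toElem (arithDivisorFunctor F₂ K₂) (unitsFunctor F₂ K₂) (divNatTrans F₂ K₂))).BaseEquivalent
          φ ψ) :=
  have h := FrdI.Thm34Sub.stdHyp_arith F₁ K₁ F₂ K₂ Ψ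
  PreFrobenioidData.preservesRel_baseEquivalent_of_isFrobenioid h.isFrobenioid₁ h.isFrobenioid₂ Ψ h.standard₁
    h.standard₂ h.hypB hsl₁ hsl₂

end Arith

/-! ### F-2378 at the `p`-adic Frobenioids -/

section Padic

variable {D₁ : Type u} [Category.{v} D₁] {D₂ : Type u} [Category.{v} D₂] {p₁ p₂ : ℕ} [Fact p₁.Prime]
  [Fact p₂.Prime] (d₁ : PadicFrd.Datum D₁ p₁) (d₂ : PadicFrd.Datum D₂ p₂)

/-- **F-2378 at `p`-adic Frobenioids** ([FrdII] Ex. 1.1 (ii); the instance [IUTchI] Ex. 3.3 (iii) consumes): EVERY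
equivalence between two `p`-adic Frobenioids over FSM-type bases carries arrows of Frobenius type to arrows of
Frobenius type of the same Frobenius degree (`FrdI.isFrobeniusCompatible_of_isOfFSMType` fed with abc-iut-f-049's
`fsmHyp_padic`). [cite: MochizukiFrdII2008, Thm 1.2 (i) p.9] -/
theorem PreFrobenioid.isFrobeniusCompatible_padic (hD₁ : IsOfFSMType D₁) (hD₂ : IsOfFSMType D₂)
    (Ψ : d₁.frobenioid ≌ d₂.frobenioid) :
    PreFrobenioid.IsFrobeniusCompatible d₁.structureFunctor d₂.structureFunctor Ψ.functor :=
  have h := FrdI.Thm34Sub.fsmHyp_padic d₁ d₂ hD₁ hD₂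
  FrdI.isFrobeniusCompatible_of_isOfFSMType h.isFrobenioid₁ h.isFrobenioid₂ h.quasiIsotropic₁ h.quasiIsotropic₂
    h.fsm₁ h.fsm₂ h.nonDilating₁ h.nonDilating₂ Ψ h.nonGroupLike₁ h.nonGroupLike₂

end Padic

end Literature.AlgebraicGeometry.Frobenioids
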